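import Summits.ResolutionOfSingularities.ResolutionOfSingularities.Theorems.WeightedInvariantELadderTwoGenSingNonempty
import Summits.ResolutionOfSingularities.ResolutionOfSingularities.Theorems.WeightedInvariantIotaMaxStratum
import HarnessLib

/-!
# Rung `e = 2`, piece (C-a) `E2MaxNonemptyBody`: the maximum locus is non-empty ONCE `mu₂` IS ATTAINED

Route `ResolutionOfSingularities/WeightedInvariant`, door crux `HypersurfaceCentreConstruction`
(stmt-ResolutionOfSingularities-19897), E2 tier; registrar res-L1-w43-plan-1, SPEC (Δ9) `E2Step_split_sketch.lean` rev 3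
(3dbfad7a331aa48b), ORDER (o47-a) (res-D-pv-031).  OURS bookkeeping; nothing here is a statement of [Hironaka2017];
AI-written, weaker than expert review.

* `E2MaxNonemptyBody p ι` — the registrar's (C-a), Lean statement VERBATIM (the `[folklore]` docstring tag of the SPEC
  is dropped: it is an OURS interface `Prop`, not a cited fact);
* `Stage.mem_maxLocus₂_of_isMaxOn` — a maximiser of `iotaAt` on `genSing₂` lies in `maxLocus₂` (`mu₂` is then attained);
* `e2MaxNonemptyBody_of_attained` — **(C-a) from ATTAINMENT**: `genSing₂ ≠ ∅` is a tree theorem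
  (`Stage.genSing₂_nonempty`, …ELadderTwoGenSingNonempty: orbit-generic points via the fibres of `q`, U6), so (C-a)
  reduces to the residual (γ) «on a non-regular stage with (I0)₂ some point of `genSing₂` maximises `iotaAt` over
  `genSing₂`» — the (c8-gr)≤3 reading on the localised unit charts (G-HT `ght_holds` supplies its dimension
  hypothesis), shared with (C-b)/(S-c); stated here as an explicit hypothesis, not as a new named `Prop`.
-/

noncomputable section

set_option linter.dupNamespace false -- mandated namespace of this single-conjunct summit

open CategoryTheory AlgebraicGeometry TopologicalSpace
open Literature.AlgebraicGeometry.Resolution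
open Summit.ResolutionOfSingularities.ResolutionOfSingularities.Theorems
open Summit.ResolutionOfSingularities.ResolutionOfSingularities.Cruxes.HypersurfaceCentreConstruction.LocalEngine

namespace Summit.ResolutionOfSingularities.ResolutionOfSingularities.Theorems.ELadderOne.Stage

variable {k : Type} [Field k] (S : Stage k) (ι : (R : Type) → [CommRing R] → R → Ordinal.{0})

/-- **A maximiser of `iotaAt` over `genSing₂` lies in the maximum locus `maxLocus₂`** (the ordinal supremum `mu₂`
is then attained, `iSup_eq_of_isMaxOn`). [folklore] -/
theorem mem_maxLocus₂_of_isMaxOn {η : S.Y} (hη : η ∈ S.genSing₂)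
    (hmax : ∀ η' ∈ S.genSing₂, iotaAt ι S.i.ker η' ≤ iotaAt ι S.i.ker η) : η ∈ S.maxLocus₂ ι :=
  ⟨hη, (iSup_eq_of_isMaxOn (iotaAt ι S.i.ker) hη hmax).symm⟩

/-- `maxLocus₂` is non-empty as soon as `iotaAt` attains its supremum on a non-empty `genSing₂`. [folklore] -/
theorem maxLocus₂_nonempty_of_exists_isMaxOn
    (h : ∃ η ∈ S.genSing₂, ∀ η' ∈ S.genSing₂, iotaAt ι S.i.ker η' ≤ iotaAt ι S.i.ker η) :
    (S.maxLocus₂ ι).Nonempty := by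
  obtain ⟨η, hη, hmax⟩ := h
  exact ⟨η, S.mem_maxLocus₂_of_isMaxOn ι hη hmax⟩

end Summit.ResolutionOfSingularities.ResolutionOfSingularities.Theorems.ELadderOne.Stage

namespace Summit.ResolutionOfSingularities.ResolutionOfSingularities.Cruxes.HypersurfaceCentreConstruction.LocalEngine

open Summit.ResolutionOfSingularities.ResolutionOfSingularities.Theorems.ELadderOne

/-- (C-a) **THE MAXIMUM IS ATTAINED** (size M): on a non-regular stage with (I0)₂ the maximum locus `maxLocus₂ ι` is non-empty —
`genSing₂` is non-empty (an orbit-generic non-regular point with ambient stalk of dimension `≤ 3`: torus-stable closed `singImage` on a unit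
chart + G-HT (o63)) and the ordinal supremum `mu₂` is attained ((c8-gr)≤3 superlevel sets closed + noetherianity; E2-CENSUS §4 U5).
[OURS · candidate · registrar SPEC (Δ9); proved below MODULO attainment as `e2MaxNonemptyBody_of_attained`] -/
def E2MaxNonemptyBody (p : ℕ) (ι : (R : Type) → [CommRing R] → R → Ordinal.{0}) : Prop :=
  ∀ ⦃k : Type⦄ [Field k] [CharP k p] [PerfectField k] (S : Stage k), S.InvDim₂ → ¬ Scheme.IsRegular S.X →
    (S.maxLocus₂ ι).Nonempty

/-- **(C-a) FROM ATTAINMENT.**  If on every non-regular stage with (I0)₂ (over perfect fields of characteristic `p`) the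
function `iotaAt ι` attains its supremum on the NON-EMPTY (`Stage.genSing₂_nonempty`) set `genSing₂`, then
`E2MaxNonemptyBody p ι`.  The hypothesis is the residual (γ) of ORDER (o47-a): the (c8-gr)≤3 reading of the rung
`PRungGrHomLE 3 p ι J` on the localised unit charts. [OURS] -/
theorem e2MaxNonemptyBody_of_attained (p : ℕ) (ι : (R : Type) → [CommRing R] → R → Ordinal.{0})
    (hatt : ∀ ⦃k : Type⦄ [Field k] [CharP k p] [PerfectField k] (S : Stage k), S.InvDim₂ →
      S.genSing₂.Nonempty → ∃ η ∈ S.genSing₂, ∀ η' ∈ S.genSing₂, iotaAt ι S.i.ker η' ≤ iotaAt ι S.i.ker η) :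
    E2MaxNonemptyBody p ι := by
  intro k _ _ _ S h0 hreg
  exact S.maxLocus₂_nonempty_of_exists_isMaxOn ι (hatt S h0 (S.genSing₂_nonempty h0 hreg))

end Summit.ResolutionOfSingularities.ResolutionOfSingularities.Cruxes.HypersurfaceCentreConstruction.LocalEngine

end
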